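import Literature.Topology.FourManifolds.HandleAttachingMaps
import Literature.Topology.FourManifolds.GluingUniqueness
import Mathlib.Geometry.Manifold.SmoothEmbedding
import HarnessLib

/-!
# Uniqueness of `M ∪ H^λ ∪ ⋯ ∪ H^λ` up to diffeomorphism; attaching no handles

Topic `Literature/Topology/FourManifolds`; a proofs-and-plumbing file below
`HandleAttachingMaps.lean` (Kosinski's attaching maps `h̄ : T → M`, `HandleAttachingMap n k M`,
and the relational attachments `HandleAttachingMap.IsAttachment h IP P` — "`P` is `M ∪ H^λ`
attached along `h̄`" — and `HandleAttachingMap.IsMultiAttachment h IP P` — "`P` is `M` with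
finitely many `λ`-handles attached simultaneously along the `h̄ᵢ`").  Those predicates are
*relational*: they say that an abstract manifold `P` is covered by open smooth embeddings of the
pieces `M ∖ ⋃ᵢ h̄ᵢ(S)` and `(Dᵐ ∖ S)ᵢ` meeting exactly along Kosinski's identification
`x ∼ h̄ᵢ α(x)`.  Existence of such a `P` is `HandleAttachingMap.exists_isMultiAttachment`
(discharged in `HandleAttachingMapsExistence.lean`); this file proves the complementary
**uniqueness**: any two multi-attachments along the same family `h̄ᵢ` are diffeomorphic — the
family version of the tree's `IsOpenGluing.nonempty_diffeomorph` (`GluingUniqueness.lean`), i.e.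
Kosinski's remark that the identification space carries *"the unique structure for which the
projections are diffeomorphisms"* onto their open images (Kosinski, *Differential Manifolds*
(1993), VI §1, proof of (1.1); VI §6 for `M ∪ H^λ`).  Consequently every statement of the form
"`P` admits a … structure" for a multi-attachment `P` may be checked on any one model of the
attachment and transported (e.g. Eliashberg's theorem `Gompf1998_thm13_twoHandles`,
`Geometry/Symplectic/SteinTwoHandles.lean`, with `IsSteinDomain.of_diffeomorph`).

## Contents (all proved)

* `exists_map_apply_eq_of_cover_family`, `contMDiff_of_comp_eq_of_cover_family` — the
  comparison map `jA a ↦ jA' a`, `jBᵢ b ↦ jB'ᵢ b` between a cover of `P` by open smooth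
  embeddings `jA`, `jBᵢ` (the `jBᵢ` with pairwise disjoint ranges) and maps `jA'`, `jB'ᵢ` into
  `P'` respecting the identifications: well defined, and smooth by descent of smoothness along
  open immersions (`contMDiffAt_of_comp_isImmersionAt`);
* `HandleAttachingMap.IsMultiAttachment.nonempty_diffeomorph` — **two simultaneous attachments
  of handles along the same attaching maps are diffeomorphic** (models with corners of `P`, `P'`
  arbitrary); `HandleAttachingMap.IsAttachment.nonempty_diffeomorph` — the one-handle form
  (literally `IsOpenGluing.nonempty_diffeomorph`);
* `HandleAttachingMap.IsMultiAttachment.self_of_isEmpty` — attaching **no** handles: `M` itself,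
  with the inclusion of `M ∖ ⋃∅ = M`, is a multi-attachment along the empty family; hence
  `HandleAttachingMap.IsMultiAttachment.nonempty_diffeomorph_of_isEmpty`: a multi-attachment
  along an empty family is diffeomorphic to `M`, and
  `HandleAttachingMap.IsMultiAttachment.compactSpace_of_isEmpty`.

## References

* A. A. Kosinski, *Differential Manifolds*, Academic Press (1993), VI §1, Theorem (1.1) and its
  proof (uniqueness of the smooth structure on an identification space), VI §6 (`M ∪ H^λ`).
  [Kosinski1993]
* R. C. Kirby, *The Topology of 4-Manifolds*, LNM 1374 (1989), Ch. I §1. [Kirby1989]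
-/

open scoped Manifold ContDiff Topology
open Set Function

noncomputable section

namespace Literature.Topology.FourManifolds

/-! ### The comparison map between two gluings of a family of pieces -/

section GlueMap

variable {ι A B P P' : Type*} {jA : A → P} {jB : ι → B → P} {jA' : A → P'} {jB' : ι → B → P'}

/-- **The comparison map between two gluings of a family of pieces**, set-theoretic part.  If
`P = jA(A) ∪ ⋃ᵢ jBᵢ(B)` with `jA`, `jBᵢ` injective and the `jBᵢ` of pairwise disjoint ranges,
and `jA' : A → P'`, `jB'ᵢ : B → P'` respect the identifications of `P`
(`jA a = jBᵢ b → jA' a = jB'ᵢ b`), then `jA a ↦ jA' a`, `jBᵢ b ↦ jB'ᵢ b` is a well defined map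
`P → P'` (Kosinski, *Differential Manifolds*, VI §1, proof of (1.1), the map `G` of (∗∗∗), for a
family of handles VI §6). [cite: Kosinski1993, Ch. VI §1, proof of Thm (1.1)] -/
theorem exists_map_apply_eq_of_cover_family (hU : range jA ∪ ⋃ i, range (jB i) = univ)
    (hinjA : Injective jA) (hinjB : ∀ i, Injective (jB i))
    (hdisj : Pairwise fun i j => Disjoint (range (jB i)) (range (jB j)))
    (hR : ∀ i a b, jA a = jB i b → jA' a = jB' i b) :
    ∃ G : P → P', (∀ a, G (jA a) = jA' a) ∧ ∀ i b, G (jB i b) = jB' i b := by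
  classical
  have hex : ∀ p, p ∉ range jA → ∃ q : ι × B, jB q.1 q.2 = p := fun p hp => by
    have hp' := (eq_univ_iff_forall.1 hU p).resolve_left hp
    simp only [mem_iUnion, mem_range] at hp'
    obtain ⟨i, b, rfl⟩ := hp'
    exact ⟨(i, b), rfl⟩
  refine ⟨fun p => if hp : p ∈ range jA then jA' (Classical.choose hp) else
      jB' (Classical.choose (hex p hp)).1 (Classical.choose (hex p hp)).2, fun a => ?_,
    fun i b => ?_⟩
  · simp only [dif_pos (mem_range_self a)]
    exact congrArg jA' (hinjA (Classical.choose_spec (mem_range_self (f := jA) a)))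
  · by_cases hp : jB i b ∈ range jA
    · simp only [dif_pos hp]
      exact hR i _ _ (Classical.choose_spec hp)
    · simp only [dif_neg hp]
      have key : ∀ q : ι × B, jB q.1 q.2 = jB i b → jB' q.1 q.2 = jB' i b := by
        rintro ⟨i', b'⟩ hq
        dsimp only at hq ⊢
        have hi : i' = i := by
          by_contra hne
          exact Set.disjoint_left.1 (hdisj hne) (mem_range_self b') ⟨b, hq.symm⟩
        subst hi
        rw [hinjB _ hq]
      exact key _ (Classical.choose_spec (hex _ hp))

end GlueMap

section GlueSmooth

variable {EA HA EB HB EP HP EP' HP' : Type*}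
  [NormedAddCommGroup EA] [NormedSpace ℝ EA] [TopologicalSpace HA] {IA : ModelWithCorners ℝ EA HA}
  [NormedAddCommGroup EB] [NormedSpace ℝ EB] [TopologicalSpace HB] {IB : ModelWithCorners ℝ EB HB}
  [NormedAddCommGroup EP] [NormedSpace ℝ EP] [TopologicalSpace HP] {IP : ModelWithCorners ℝ EP HP}
  [NormedAddCommGroup EP'] [NormedSpace ℝ EP'] [TopologicalSpace HP']
  {IP' : ModelWithCorners ℝ EP' HP'}
  {ι A B P P' : Type*} [TopologicalSpace A] [ChartedSpace HA A] [TopologicalSpace B]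
  [ChartedSpace HB B] [TopologicalSpace P] [ChartedSpace HP P] [TopologicalSpace P']
  [ChartedSpace HP' P']
  {jA : A → P} {jB : ι → B → P} {jA' : A → P'} {jB' : ι → B → P'}

/-- The comparison map `G : P → P'` between a cover `P = jA(A) ∪ ⋃ᵢ jBᵢ(B)` by open smooth
embeddings and smooth maps `jA' = G ∘ jA`, `jB'ᵢ = G ∘ jBᵢ` is smooth: locally it is
`jA' ∘ jA⁻¹` or `jB'ᵢ ∘ jBᵢ⁻¹` (`contMDiffAt_of_comp_isImmersionAt`, descent of smoothness along
an open immersion) (Kosinski, *Differential Manifolds*, VI §1, proof of (1.1): "the unique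
structure for which the projections are diffeomorphisms").
[cite: Kosinski1993, Ch. VI §1, proof of Thm (1.1)] -/
theorem contMDiff_of_comp_eq_of_cover_family [IsManifold IP' ∞ P']
    (hA : Manifold.IsSmoothEmbedding IA IP ∞ jA) (hAo : IsOpen (range jA))
    (hB : ∀ i, Manifold.IsSmoothEmbedding IB IP ∞ (jB i)) (hBo : ∀ i, IsOpen (range (jB i)))
    (hU : range jA ∪ ⋃ i, range (jB i) = univ) (hA' : ContMDiff IA IP' ∞ jA')
    (hB' : ∀ i, ContMDiff IB IP' ∞ (jB' i))
    {G : P → P'} (hGA : ∀ a, G (jA a) = jA' a) (hGB : ∀ i b, G (jB i b) = jB' i b) :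
    ContMDiff IP IP' ∞ G := by
  intro p
  rcases eq_univ_iff_forall.1 hU p with ⟨a, rfl⟩ | hp
  · exact contMDiffAt_of_comp_isImmersionAt (hA.isImmersion.isImmersionAt a)
      (_root_.Topology.IsOpenEmbedding.isOpenMap ⟨hA.isEmbedding, hAo⟩) (hA' a) hGA
  · simp only [mem_iUnion, mem_range] at hp
    obtain ⟨i, b, rfl⟩ := hp
    exact contMDiffAt_of_comp_isImmersionAt ((hB i).isImmersion.isImmersionAt b)
      (_root_.Topology.IsOpenEmbedding.isOpenMap ⟨(hB i).isEmbedding, hBo i⟩) (hB' i b) (hGB i)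

end GlueSmooth

/-! ### Uniqueness of handle attachments up to diffeomorphism -/

namespace HandleAttachingMap

section Unique

variable {n k : ℕ} {M : Type*} [TopologicalSpace M] [ChartedSpace (EuclideanHalfSpace (n + 1)) M]
  [T2Space M]
  {EP HP EP' HP' : Type*} [NormedAddCommGroup EP] [NormedSpace ℝ EP] [TopologicalSpace HP]
  {IP : ModelWithCorners ℝ EP HP} [NormedAddCommGroup EP'] [NormedSpace ℝ EP']
  [TopologicalSpace HP'] {IP' : ModelWithCorners ℝ EP' HP'}
  {P : Type*} [TopologicalSpace P] [ChartedSpace HP P]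
  {P' : Type*} [TopologicalSpace P'] [ChartedSpace HP' P']

/-- **Uniqueness of `M ∪ H^λ ∪ ⋯ ∪ H^λ` up to diffeomorphism.**  Two manifolds `P`, `P'` which
are both `M` with handles attached simultaneously along the same attaching maps `h̄ᵢ`
(`HandleAttachingMap.IsMultiAttachment h IP P`, `… h IP' P'`; the models with corners of `P` and
`P'` are arbitrary) are diffeomorphic: the comparison maps `jA a ↦ jA' a`, `jBᵢ b ↦ jB'ᵢ b` and
back are well defined because both covers meet exactly along Kosinski's relation
`x ∼ h̄ᵢ α(x)` (`HandleAttachingMap.glueRel`) with the handle pieces pairwise disjoint, and they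
are smooth by descent along the open smooth embeddings of the pieces.  This is Kosinski's
uniqueness of the smooth structure on the identification space, *"the unique structure for which
the projections are diffeomorphisms"* (VI §1, proof of (1.1)), for the attachment `M ∪ H^λ` of
VI §6 and several handles at once. [cite: Kosinski1993, Ch. VI §1, proof of Thm (1.1)] -/
theorem IsMultiAttachment.nonempty_diffeomorph [IsManifold IP ∞ P] [IsManifold IP' ∞ P']
    {ι : Type*} [Finite ι] {h : ι → HandleAttachingMap n k M}
    (hP : IsMultiAttachment h IP P) (hP' : IsMultiAttachment h IP' P') :
    Nonempty (P ≃ₘ⟮IP, IP'⟯ P') := by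
  obtain ⟨-, jA, jB, hjA, hjAo, hjB, hcov, hglue, hdisjB⟩ := hP
  obtain ⟨-, jA', jB', hjA', hjAo', hjB', hcov', hglue', hdisjB'⟩ := hP'
  have hRR' : ∀ i a b, jA a = jB i b → jA' a = jB' i b := fun i a b e =>
    (hglue' i a b).2 ((hglue i a b).1 e)
  have hR'R : ∀ i a b, jA' a = jB' i b → jA a = jB i b := fun i a b e =>
    (hglue i a b).2 ((hglue' i a b).1 e)
  obtain ⟨G, hGA, hGB⟩ := exists_map_apply_eq_of_cover_family hcov hjA.isEmbedding.injective
    (fun i => (hjB i).1.isEmbedding.injective) hdisjB hRR'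
  obtain ⟨G', hGA', hGB'⟩ := exists_map_apply_eq_of_cover_family hcov' hjA'.isEmbedding.injective
    (fun i => (hjB' i).1.isEmbedding.injective) hdisjB' hR'R
  refine ⟨{ toFun := G
            invFun := G'
            left_inv := fun p => ?_
            right_inv := fun p => ?_
            contMDiff_toFun := contMDiff_of_comp_eq_of_cover_family hjA hjAo (fun i => (hjB i).1)
              (fun i => (hjB i).2) hcov hjA'.contMDiff (fun i => (hjB' i).1.contMDiff) hGA hGB
            contMDiff_invFun := contMDiff_of_comp_eq_of_cover_family hjA' hjAo'
              (fun i => (hjB' i).1) (fun i => (hjB' i).2) hcov' hjA.contMDiff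
              (fun i => (hjB i).1.contMDiff) hGA' hGB' }⟩
  · rcases eq_univ_iff_forall.1 hcov p with ⟨a, rfl⟩ | hp
    · rw [hGA, hGA']
    · simp only [mem_iUnion, mem_range] at hp
      obtain ⟨i, b, rfl⟩ := hp
      rw [hGB, hGB']
  · rcases eq_univ_iff_forall.1 hcov' p with ⟨a, rfl⟩ | hp
    · rw [hGA', hGA]
    · simp only [mem_iUnion, mem_range] at hp
      obtain ⟨i, b, rfl⟩ := hp
      rw [hGB', hGB]

omit [NormedAddCommGroup EP'] [NormedSpace ℝ EP'] in
/-- **Uniqueness of `M ∪ H^λ` up to diffeomorphism** (one handle): two attachments of a handle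
along the same attaching map `h̄` are diffeomorphic — literally the tree's uniqueness of open
gluings `IsOpenGluing.nonempty_diffeomorph`, an attachment being the open gluing of `M ∖ h̄(S)`
and `Dᵐ ∖ S` along `HandleAttachingMap.glueRel`. [cite: Kosinski1993, Ch. VI §1, proof of Thm (1.1)] -/
theorem IsAttachment.nonempty_diffeomorph {IP' : ModelWithCorners ℝ EP HP'}
    [IsManifold IP ∞ P] [IsManifold IP' ∞ P'] {h : HandleAttachingMap n k M}
    (hP : h.IsAttachment IP P) (hP' : h.IsAttachment IP' P') : Nonempty (P ≃ₘ⟮IP, IP'⟯ P') :=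
  IsOpenGluing.nonempty_diffeomorph hP hP'

/-! ### Attaching no handles -/

/-- **Attaching no handles gives `M` back**: for an empty family of attaching maps, `M` itself —
covered by the inclusion of the open submanifold `M ∖ ⋃∅ h̄ᵢ(S) = M` (a smooth embedding with
open range, Mathlib's `Manifold.IsSmoothEmbedding.of_opens`) and no handle pieces — is a
multi-attachment along the family (all conditions on the handles are vacuous). [folklore] -/
theorem IsMultiAttachment.self_of_isEmpty [IsManifold (𝓡∂ (n + 1)) ∞ M] {ι : Type*} [Finite ι]
    [IsEmpty ι] (h : ι → HandleAttachingMap n k M) : IsMultiAttachment h (𝓡∂ (n + 1)) M := by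
  have hr : range (Subtype.val : ↥(coresComplement h) → M) = univ := by
    rw [Subtype.range_coe_subtype]
    exact eq_univ_of_forall fun a => (mem_coresComplement h).2 fun i => isEmptyElim i
  refine ⟨fun i => isEmptyElim i, Subtype.val, fun i => isEmptyElim i,
    Manifold.IsSmoothEmbedding.of_opens _, ?_, fun i => isEmptyElim i, ?_, fun i => isEmptyElim i,
    fun i => isEmptyElim i⟩
  · rw [hr]; exact isOpen_univ
  · rw [hr]; exact univ_union _

/-- **A multi-attachment along an empty family of attaching maps is diffeomorphic to `M`**
(uniqueness of multi-attachments, `IsMultiAttachment.nonempty_diffeomorph`, against the model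
`M` of `IsMultiAttachment.self_of_isEmpty`). [folklore] -/
theorem IsMultiAttachment.nonempty_diffeomorph_of_isEmpty [IsManifold (𝓡∂ (n + 1)) ∞ M]
    [IsManifold IP ∞ P] {ι : Type*} [Finite ι] [IsEmpty ι] {h : ι → HandleAttachingMap n k M}
    (hP : IsMultiAttachment h IP P) : Nonempty (P ≃ₘ⟮IP, 𝓡∂ (n + 1)⟯ M) :=
  hP.nonempty_diffeomorph (IsMultiAttachment.self_of_isEmpty h)

/-- A multi-attachment along an empty family to a compact `M` is compact (it is diffeomorphic,
in particular homeomorphic, to `M`). [folklore] -/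
theorem IsMultiAttachment.compactSpace_of_isEmpty [IsManifold (𝓡∂ (n + 1)) ∞ M] [CompactSpace M]
    [IsManifold IP ∞ P] {ι : Type*} [Finite ι] [IsEmpty ι] {h : ι → HandleAttachingMap n k M}
    (hP : IsMultiAttachment h IP P) : CompactSpace P := by
  obtain ⟨e⟩ := hP.nonempty_diffeomorph_of_isEmpty
  exact e.toHomeomorph.symm.compactSpace

end Unique

end HandleAttachingMap

end Literature.Topology.FourManifolds

end
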